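import Summits.Schanuel.Schanuel.Theorems.SoloInformedBilinearFloor
import Literature.NumberTheory.Transcendental.NesterenkoCriterion

/-!
# Door (N): the linear-form currency — box ladder and Nesterenko's criterion at `(e, π)`
# (soloist Proposition CC)

Soloist file (`solo-Schanuel-informed`, residency session s57, 2026-08-22), companion of
`SoloInformedBilinearFloor` (Proposition W).  That file records in prose ("Reading") what the
linear-form engine could see at the point `(e, π)`; this file TYPES it, using the library's
kernel proof of Nesterenko's linear independence criterion in exact-rate form
(`Literature.NumberTheory.Transcendental.nesterenko_criterion`).  Nothing is deep; the point is
the exact typing of one more door into the first open rung `e ⟂ π` of Schanuel's conjecture and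
of its threshold (atlas §2 M8 / E19, §5 W3 of the soloist's statement).

## Statements

Write `x = (e, π)` and, for `d ≥ 0`, `Box_d(x)` for the family of the `(d+1)²` monomials
`eⁱ πʲ`, `0 ≤ i, j ≤ d` (in general, for `x ∈ ℝⁿ`, the `(d+1)ⁿ` monomials of multidegree
`≤ (d, …, d)`, `boxMonomial x d`, indexed by `Fin n → Fin (d+1)`).

* §1 (the box ladder — a normal form).  For every `x ∈ ℝⁿ`:
  `x` algebraically independent over `ℚ` `⟺` for every `d ≥ 1`, `Box_d(x)` is `ℚ`-linearly
  independent (`algebraicIndependent_iff_forall_box`).  At `(e, π)`: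
  `e ⟂ π ⟺ ∀ d ≥ 1, Box_d(e, π)` `ℚ`-linearly independent
  (`expOnePiAlgebraicIndependent_iff_forall_box`), and the first rung IS the bilinear floor:
  `Box_1(e, π) = {1, e, π, eπ}`, `BilinearFloor ⟺ Box_1` (`bilinearFloor_iff_box_one`).  So the
  open floor of Proposition W is the `d = 1` truncation of an exhaustive ladder whose conjunction
  is `e ⟂ π`; every rung `d ≥ 1` is open.
* §2 (door (N): Nesterenko data).  `nesterenkoData θ α β` is the set of sequences of integer
  vectors `pₙ` with `log |∑ᵢ pₙ,ᵢ θᵢ| / n → log α` (exact rate) and `log |pₙ,ᵢ| ≤ n log β + o(n)`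
  (used with `0 < α < 1 < β`); write `τ := −log α / log β` for the exponent.  Nesterenko's
  criterion gives `dim_ℚ ⟨θ⟩ ≥ 1 + τ` (`finrank_ge_of_mem_nesterenkoData`, any finite index
  type), hence data with `#θ − 1 < 1 + τ` force `θ` to be `ℚ`-linearly independent
  (`linearIndependent_of_mem_nesterenkoData`).  Doors:
  (a) Nesterenko data on `(1, e, π, eπ)` with `1 + τ > 3` (i.e. `τ > 2`) `⟹ BilinearFloor`
      (`bilinearFloor_of_nesterenkoData`);
  (a′) the same for data on `Box_1(e, π)` in the ladder's indexing, through (ii)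
      (`bilinearFloor_of_boxOne_nesterenkoData`) — the first rung of door (b) is door (a);
  (b) for every `d ≥ 1` data on `Box_d(e, π)` with `1 + τ_d > (d+1)² − 1` `⟹ e ⟂ π`
      (`expOnePiAlgebraicIndependent_of_nesterenkoData`).
  In the range `1 < τ ≤ 2` the criterion returns `dim_ℚ ⟨1, e, π, eπ⟩ ≥ 3`, which is
  Proposition W (i) (`three_le_finrank_span`) unconditionally; below `τ ≤ 1` it returns less.

## Reading (atlas §2 M8 / E19, §5 W3)

Every family of integer linear forms in `(1, e, π, eπ)` in print is a sum or product of the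
Hermite–Padé forms in `(1, e)` (exponent `1`) and hypergeometric forms in `(1, π)` (exponent
`≈ 0.16`); exponents of products combine convexly and a sum is dominated by its worse summand, so
`τ ≤ 1` [FischlerRivoal2012, Théorème 3 with `k = 1`, for the shape of the criterion; Finch2003
§2.22 for "no one has improved on `r(e, π) ≤ max{r(e), r(π)}`"].  Door (a) asks for `τ > 2`, door
(b) for `τ_d → ∞` quadratically in `d`: a JOINT Apéry-type phenomenon in two exponential types, of
which no instance is known (the soloist's watch-list item W3).  The doors are typed here so that
the distance is a number: available `τ ≤ 1`, floor `τ > 2`, rung `d` at `τ_d > d² + 2d − 1`.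

## References

* [Nesterenko1985] Yu. V. Nesterenko, On the linear independence of numbers, Vestnik Moskov.
  Univ. Ser. I (1985) no. 1, 46–49 (Moscow Univ. Math. Bull. 40 (1985) 69–74) — used through
  the library file `Literature/NumberTheory/Transcendental/NesterenkoCriterion.lean`
  (exact-rate form, after Rivoal 2000 §1; proved there).
* [FischlerRivoal2012] S. Fischler, T. Rivoal, arXiv:1202.2279, Théorème 3.
* [Finch2003] S. R. Finch, *Mathematical Constants*, Cambridge Univ. Press 2003, §2.22.
-/

noncomputable section

open Filter Topology Finset
open Literature.NumberTheory.Transcendental (ExpOnePiAlgebraicIndependent nesterenko_criterion)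

namespace Summit.Schanuel.Schanuel.Theorems

/-! ### §1 The box ladder -/

section Box

variable {n : ℕ}

/-- The box of monomials of multidegree `≤ (d, …, d)` at `x ∈ ℝⁿ`: `f ↦ ∏ᵢ xᵢ ^ (f i)`,
indexed by `f : Fin n → Fin (d + 1)`. -/
def boxMonomial (x : Fin n → ℝ) (d : ℕ) (f : Fin n → Fin (d + 1)) : ℝ :=
  ∏ i, x i ^ (f i : ℕ)

/-- The exponent vector of a box index. -/
def boxExp (d : ℕ) (f : Fin n → Fin (d + 1)) : Fin n →₀ ℕ :=
  Finsupp.equivFunOnFinite.symm fun i => (f i : ℕ)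

/-- The exponent vector of a box index has the index's entries. -/
@[simp] theorem boxExp_apply (d : ℕ) (f : Fin n → Fin (d + 1)) (i : Fin n) :
    boxExp d f i = f i := by
  simp [boxExp]

/-- Distinct box indices have distinct exponent vectors. -/
theorem boxExp_injective (d : ℕ) : Function.Injective (boxExp (n := n) d) := by
  intro f g h
  funext i
  have hi := congrArg (fun m : Fin n →₀ ℕ => m i) h
  simp only [boxExp_apply] at hi
  exact Fin.ext hi

/-- Evaluating the monomial with a box exponent at `x` gives the box monomial. -/
theorem aeval_monomial_boxExp (x : Fin n → ℝ) (d : ℕ) (f : Fin n → Fin (d + 1)) (c : ℚ) :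
    MvPolynomial.aeval x (MvPolynomial.monomial (boxExp d f) c) = (c : ℝ) * boxMonomial x d f := by
  rw [MvPolynomial.aeval_monomial, Finsupp.prod_fintype _ _ (fun i => pow_zero _)]
  simp [boxMonomial]

/-- Every exponent vector with all entries `≤ d` is a box exponent. -/
theorem exists_boxExp_eq (d : ℕ) {m : Fin n →₀ ℕ} (hm : ∀ i, m i ≤ d) :
    ∃ f : Fin n → Fin (d + 1), boxExp d f = m :=
  ⟨fun i => ⟨m i, Nat.lt_succ_of_le (hm i)⟩, by ext i; simp⟩

/-- **Box ladder, easy half.** Algebraic independence gives the linear independence of every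
box of monomials. -/
theorem box_linearIndependent_of_algebraicIndependent {x : Fin n → ℝ}
    (hx : AlgebraicIndependent ℚ x) (d : ℕ) : LinearIndependent ℚ (boxMonomial x d) := by
  classical
  rw [Fintype.linearIndependent_iff]
  intro g hg f
  set Q : MvPolynomial (Fin n) ℚ := ∑ f', MvPolynomial.monomial (boxExp d f') (g f') with hQdef
  have hQ : MvPolynomial.aeval x Q = 0 := by
    rw [hQdef, map_sum]
    simp only [aeval_monomial_boxExp]
    simpa [Rat.smul_def] using hg
  have hQ0 : Q = 0 := (algebraicIndependent_iff.mp hx) Q hQ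
  have hc := congrArg (MvPolynomial.coeff (boxExp d f)) hQ0
  rw [MvPolynomial.coeff_zero, hQdef, MvPolynomial.coeff_sum] at hc
  simp only [MvPolynomial.coeff_monomial, (boxExp_injective d).eq_iff] at hc
  simpa using hc

/-- **Box ladder, the door direction.** If every box of monomials (from `d = 1` on) is
`ℚ`-linearly independent, then `x` is algebraically independent over `ℚ`. -/
theorem algebraicIndependent_of_forall_box (x : Fin n → ℝ)
    (h : ∀ d : ℕ, 1 ≤ d → LinearIndependent ℚ (boxMonomial x d)) :
    AlgebraicIndependent ℚ x := by
  classical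
  rw [algebraicIndependent_iff]
  intro P hP
  set d : ℕ := max 1 P.totalDegree with hd
  have hd1 : 1 ≤ d := le_max_left _ _
  have hsupp : ∀ m ∈ P.support, ∀ i, m i ≤ d := fun m hm i =>
    ((MvPolynomial.monomial_le_degreeOf i hm).trans (MvPolynomial.degreeOf_le_totalDegree P i)).trans
      (le_max_right _ _)
  -- the value of `P` at `x` as a `ℚ`-combination of the box monomials
  set F : (Fin n →₀ ℕ) → ℝ := fun v => ((P.coeff v : ℚ) : ℝ) * ∏ i, x i ^ (v i) with hFdef
  set g : (Fin n → Fin (d + 1)) → ℚ := fun f => P.coeff (boxExp d f) with hgdef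
  have hF : ∀ f, g f • boxMonomial x d f = F (boxExp d f) := by
    intro f
    simp only [hFdef, hgdef, boxMonomial, boxExp_apply, Rat.smul_def]
  set emb : (Fin n → Fin (d + 1)) ↪ (Fin n →₀ ℕ) := ⟨boxExp d, boxExp_injective d⟩ with hemb
  have hsub : P.support ⊆ Finset.univ.map emb := by
    intro m hm
    obtain ⟨f, hf⟩ := exists_boxExp_eq d (hsupp m hm)
    exact Finset.mem_map.mpr ⟨f, Finset.mem_univ _, hf⟩
  have h1 : ∑ f, g f • boxMonomial x d f = ∑ v ∈ Finset.univ.map emb, F v := by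
    rw [Finset.sum_map]
    exact Finset.sum_congr rfl fun f _ => hF f
  have h2 : ∑ v ∈ P.support, F v = ∑ v ∈ Finset.univ.map emb, F v := by
    refine Finset.sum_subset hsub fun v _ hv => ?_
    have hv0 : P.coeff v = 0 := by simpa [MvPolynomial.mem_support_iff] using hv
    simp [hFdef, hv0]
  have h3 : MvPolynomial.aeval x P = ∑ v ∈ P.support, F v := by
    conv_lhs => rw [P.as_sum]
    rw [map_sum]
    refine Finset.sum_congr rfl fun v _ => ?_
    rw [MvPolynomial.aeval_monomial, Finsupp.prod_fintype _ _ (fun i => pow_zero _)]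
    simp [hFdef]
  have hsum : ∑ f, g f • boxMonomial x d f = 0 := by rw [h1, ← h2, ← h3, hP]
  have hg := (Fintype.linearIndependent_iff.mp (h d hd1)) g hsum
  ext m
  rw [MvPolynomial.coeff_zero]
  by_cases hm : m ∈ P.support
  · obtain ⟨f, hf⟩ := exists_boxExp_eq d (hsupp m hm)
    have hgf : P.coeff (boxExp d f) = 0 := hg f
    rwa [hf] at hgf
  · simpa [MvPolynomial.mem_support_iff] using hm

/-- **Proposition CC (i), the box ladder.** `x ∈ ℝⁿ` is algebraically independent over `ℚ` iff
every box of monomials `Box_d(x)`, `d ≥ 1`, is `ℚ`-linearly independent. -/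
theorem algebraicIndependent_iff_forall_box (x : Fin n → ℝ) :
    AlgebraicIndependent ℚ x ↔ ∀ d : ℕ, 1 ≤ d → LinearIndependent ℚ (boxMonomial x d) :=
  ⟨fun hx d _ => box_linearIndependent_of_algebraicIndependent hx d,
    algebraicIndependent_of_forall_box x⟩

end Box

/-! ### §1′ The ladder at `(e, π)`; its first rung is the bilinear floor -/

/-- `e ⟂ π ⟺` every box `{eⁱπʲ : i, j ≤ d}`, `d ≥ 1`, is `ℚ`-linearly independent. -/
theorem expOnePiAlgebraicIndependent_iff_forall_box :
    ExpOnePiAlgebraicIndependent ↔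
      ∀ d : ℕ, 1 ≤ d → LinearIndependent ℚ (boxMonomial ![Real.exp 1, Real.pi] d) :=
  algebraicIndependent_iff_forall_box _

/-- The enumeration `0 ↦ (0,0), 1 ↦ (1,0), 2 ↦ (0,1), 3 ↦ (1,1)` of the box `d = 1` in two
variables. -/
def boxOneIdx : Fin 4 → (Fin 2 → Fin 2) := ![![0, 0], ![1, 0], ![0, 1], ![1, 1]]

/-- `boxOneIdx` enumerates the box `d = 1` in two variables bijectively. -/
theorem boxOneIdx_bijective : Function.Bijective boxOneIdx := by
  decide

/-- `Box_1(e, π)` enumerated by `boxOneIdx` is literally `(1, e, π, eπ)`. -/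
theorem boxMonomial_one_comp_boxOneIdx :
    boxMonomial ![Real.exp 1, Real.pi] 1 ∘ boxOneIdx =
      ![(1 : ℝ), Real.exp 1, Real.pi, Real.exp 1 * Real.pi] := by
  funext i
  fin_cases i <;> simp [boxMonomial, boxOneIdx, Fin.prod_univ_two]

/-- **Proposition CC (ii).** The bilinear floor IS the first rung of the box ladder:
`BilinearFloor ⟺ Box_1(e, π)` `ℚ`-linearly independent.  (So `e ⟂ π ⟹ BilinearFloor`, the
companion file's `bilinearFloor_of_expOnePiAlgebraicIndependent`, is the ladder read at `d = 1`.) -/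
theorem bilinearFloor_iff_box_one :
    BilinearFloor ↔ LinearIndependent ℚ (boxMonomial ![Real.exp 1, Real.pi] 1) := by
  rw [BilinearFloor, ← boxMonomial_one_comp_boxOneIdx]
  exact linearIndependent_equiv (Equiv.ofBijective boxOneIdx boxOneIdx_bijective)

/-! ### §2 Door (N): Nesterenko data -/

section Nesterenko

variable {ι : Type*}

/-- **Nesterenko data** for a finite family of reals `θ` with rate `α` and growth `β`: the set of
sequences of integer coefficient vectors `pₙ` with EXACT rate `log |∑ᵢ pₙ,ᵢ θᵢ| / n → log α` and
growth `log |pₙ,ᵢ| ≤ n log β + o(n)` (the hypotheses of `nesterenko_criterion`, for an arbitrary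
finite index type; used with `0 < α < 1 < β`).  The exponent of such data is `τ = −log α / log β`. -/
def nesterenkoData [Fintype ι] (θ : ι → ℝ) (α β : ℝ) : Set (ℕ → ι → ℤ) :=
  {p | Tendsto (fun n : ℕ => Real.log |∑ i, (p n i : ℝ) * θ i| / n) atTop (𝓝 (Real.log α)) ∧
    ∀ i, ∀ ε : ℝ, 0 < ε → ∀ᶠ n : ℕ in atTop, Real.log |(p n i : ℝ)| ≤ n * Real.log β + ε * n}

/-- Nesterenko's criterion for an arbitrary finite index type: Nesterenko data with
`0 < α < 1 < β` give `dim_ℚ ⟨θ⟩ ≥ 1 − log α / log β` (`= 1 + τ`). -/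
theorem finrank_ge_of_mem_nesterenkoData [Fintype ι] (θ : ι → ℝ) {α β : ℝ} {p : ℕ → ι → ℤ}
    (hα : 0 < α) (hα1 : α < 1) (hβ : 1 < β) (hp : p ∈ nesterenkoData θ α β) :
    1 - Real.log α / Real.log β ≤
      (Module.finrank ℚ (Submodule.span ℚ (Set.range θ)) : ℝ) := by
  classical
  obtain ⟨h1, h2⟩ := hp
  set e := Fintype.equivFin ι with he
  have key := nesterenko_criterion (θ ∘ e.symm) (fun n => p n ∘ e.symm) hα hα1 hβ ?_ ?_
  · rwa [e.symm.surjective.range_comp] at key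
  · have hs : ∀ n : ℕ, ∑ i, ((p n ∘ e.symm) i : ℝ) * (θ ∘ e.symm) i = ∑ i, (p n i : ℝ) * θ i :=
      fun n => Equiv.sum_comp e.symm (fun j => (p n j : ℝ) * θ j)
    simp only [hs]
    exact h1
  · intro i ε hε
    exact h2 (e.symm i) ε hε

/-- **Beyond the threshold the family is free.** Nesterenko data with `#θ − 1 < 1 + τ` force
`θ` to be `ℚ`-linearly independent (the span has dimension `≤ #θ` and `> #θ − 1`). -/
theorem linearIndependent_of_mem_nesterenkoData [Fintype ι] (θ : ι → ℝ) {α β : ℝ}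
    {p : ℕ → ι → ℤ} (hα : 0 < α) (hα1 : α < 1) (hβ : 1 < β) (hp : p ∈ nesterenkoData θ α β)
    (hτ : (Fintype.card ι : ℝ) - 1 < 1 - Real.log α / Real.log β) :
    LinearIndependent ℚ θ := by
  classical
  rw [linearIndependent_iff_card_eq_finrank_span]
  have hle : (Set.range θ).finrank ℚ ≤ Fintype.card ι := finrank_range_le_card θ
  have hge : (Fintype.card ι : ℝ) - 1 < ((Set.range θ).finrank ℚ : ℝ) :=
    hτ.trans_le (finrank_ge_of_mem_nesterenkoData θ hα hα1 hβ hp)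
  have h' : Fintype.card ι < (Set.range θ).finrank ℚ + 1 := by
    have : (Fintype.card ι : ℝ) < ((Set.range θ).finrank ℚ : ℝ) + 1 := by linarith
    exact_mod_cast this
  omega

end Nesterenko

/-- **Door (N)(a): a joint family with exponent `τ > 2` gives the bilinear floor.**
(`3 < 1 − log α / log β` is `τ > 2`.)  In the range `2 < 1 − log α/log β ≤ 3` the criterion
yields only `dim ≥ 3`, i.e. `three_le_finrank_span`, which holds unconditionally. -/
theorem bilinearFloor_of_nesterenkoData {α β : ℝ} {p : ℕ → Fin 4 → ℤ}
    (hα : 0 < α) (hα1 : α < 1) (hβ : 1 < β)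
    (hp : p ∈ nesterenkoData ![(1 : ℝ), Real.exp 1, Real.pi, Real.exp 1 * Real.pi] α β)
    (hτ : 3 < 1 - Real.log α / Real.log β) : BilinearFloor :=
  linearIndependent_of_mem_nesterenkoData _ hα hα1 hβ hp
    ((by norm_num : ((Fintype.card (Fin 4) : ℕ) : ℝ) - 1 = 3).trans_lt hτ)

/-- **Door (N)(a′): the first rung of door (b) is door (a).**  Nesterenko data on the box
`Box_1(e, π)` (indexed by `Fin 2 → Fin 2`) with `3 < 1 + τ` give the bilinear floor, through
`bilinearFloor_iff_box_one`. -/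
theorem bilinearFloor_of_boxOne_nesterenkoData {α β : ℝ} {p : ℕ → (Fin 2 → Fin (1 + 1)) → ℤ}
    (hα : 0 < α) (hα1 : α < 1) (hβ : 1 < β)
    (hp : p ∈ nesterenkoData (boxMonomial ![Real.exp 1, Real.pi] 1) α β)
    (hτ : 3 < 1 - Real.log α / Real.log β) : BilinearFloor :=
  bilinearFloor_iff_box_one.mpr
    (linearIndependent_of_mem_nesterenkoData _ hα hα1 hβ hp
      ((by norm_num [Fintype.card_fun, Fintype.card_fin] :
          ((Fintype.card (Fin 2 → Fin (1 + 1)) : ℕ) : ℝ) - 1 = 3).trans_lt hτ))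

/-- **Door (N)(b): joint families on every box give `e ⟂ π`.**  If for every `d ≥ 1` the box
`Box_d(e, π)` of `(d+1)²` monomials `eⁱπʲ` carries Nesterenko data of exponent `τ_d` with
`(d+1)² − 1 < 1 + τ_d`, then `e` and `π` are algebraically independent (through the box ladder
`expOnePiAlgebraicIndependent_iff_forall_box`; the same proof serves any `x ∈ ℝⁿ` with `(d+1)ⁿ`
in place of `(d+1)²`, by `algebraicIndependent_of_forall_box`). -/
theorem expOnePiAlgebraicIndependent_of_nesterenkoData
    (h : ∀ d : ℕ, 1 ≤ d → ∃ α β : ℝ, ∃ p : ℕ → (Fin 2 → Fin (d + 1)) → ℤ,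
      0 < α ∧ α < 1 ∧ 1 < β ∧ p ∈ nesterenkoData (boxMonomial ![Real.exp 1, Real.pi] d) α β ∧
        ((d + 1) ^ 2 : ℝ) - 1 < 1 - Real.log α / Real.log β) :
    ExpOnePiAlgebraicIndependent := by
  refine expOnePiAlgebraicIndependent_iff_forall_box.mpr fun d hd => ?_
  obtain ⟨α, β, p, hα, hα1, hβ, hp, hτ⟩ := h d hd
  refine linearIndependent_of_mem_nesterenkoData _ hα hα1 hβ hp ?_
  simpa [Fintype.card_fun, Fintype.card_fin] using hτ

end Summit.Schanuel.Schanuel.Theorems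

end
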